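import Mathlib.LinearAlgebra.BilinearForm.Properties
import Literature.AlgebraicGeometry.HodgeTheory.LocallyTrivialExtensionClasses
import Summits.HodgeConjecture.HodgeConjecture.Theorems.LinearSystemTorelliLocalTubeSpanTransvections
import Summits.HodgeConjecture.HodgeConjecture.Theorems.LinearSystemTorelliLocalTubeSpanSaturation

/-!
# Route LinearSystemTorelli — crux `LocalTubeSpan`: unimodular absorption

Helper file (`--supports stmt-HodgeConjecture-2490`, line `Sketch`, cycle 5, stub
`stub_unimodularPencil`).  The crux ("local Schnell theorem", [Schnell2010] §7) concerns a local
monodromy group acting on the vanishing cohomology `V` (a `ℚ`-representation `A`, alternating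
intersection form `B`) through the Picard–Lefschetz transvections `T_δ(x) = x - B(x, δ) δ` along
vanishing cycles `δ`.  The positive results of the line consume REALISED transvections: elements
of the local group acting as `T_δ` for enough vectors `δ` (`…Saturation`, `…UnimodularChain`,
`…ConnectedCluster`).  This file supplies them wholesale for a unimodular pencil of two cycles:

* `localTubeSpan_unimodularPencil` (the registered stub) — **unimodular absorption**: if `t_a, t_b`
  act as `T_a, T_b` with `B(a, b) = 1`, then for EVERY `(m, n) ∈ ℤ²` some element of `⟨t_a, t_b⟩`
  acts as the transvection along `m a + n b` (the group acts on `ℚa ⊕ ℚb` as `SL₂(ℤ)` in the basis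
  `(a, b)` and trivially on the `B`-orthogonal complement).

Proof.  Strong induction on `|m| + |n|`.  If `n = 0` (resp. `m = 0`) the transvection along
`m a` is `T_a^{m²}` (resp. `T_b^{n²}`), a power of a generator
(`localTubeSpan_pow_transvection_formula`: `T_v^j(x) = x - j B(x, v) v` since `B(v, v) = 0`;
`localTubeSpan_realised_smul_transvection`).  Otherwise one of the four Euclidean moves
`t_b^{±1} · (m a + n' b) = m a + (n' ∓ m) b`, `t_a^{±1} · (m' a + n b) = (m' ± n) a + n b`
(`localTubeSpan_pencil_move_*`, from `B(p a + q b, b) = p`, `B(p a + q b, a) = -q`) writes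
`m a + n b = h · v'` with `h ∈ {t_a^{±1}, t_b^{±1}}` and `v'` of smaller weight; by induction some
`g ∈ ⟨t_a, t_b⟩` acts as `T_{v'}`, and then the conjugate meridian `h g h⁻¹` acts as `T_{h · v'}`
(`localTubeSpan_conj_transvection_formula_of_isometry`; the group acts by `B`-isometries,
`localTubeSpan_pencil_isometry`).  Elementary linear algebra over `ℚ`; no named facts.

References: [Schnell2010] C. Schnell, *Primitive cohomology and the tube mapping*, Math. Z. 268
(2010), §7 (skew-symmetric vanishing lattices); [Janssen1983] W. A. M. Janssen, *Skew-symmetric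
vanishing lattices and their monodromy groups*, Math. Ann. 266 (1983) (rank-two unimodular
sublattices and the `SL₂(ℤ)` they carry).
-/

-- `Summit.HodgeConjecture.HodgeConjecture.Theorems` is the mandated namespace (single-conjunct
-- summit: Sub = Summit), which `linter.dupNamespace` flags on every declaration; the lakefile turns
-- the linter off tree-wide (weak option), restated here so stand-alone elaboration is warning-free.
set_option linter.dupNamespace false

noncomputable section

open Literature.AlgebraicGeometry.HodgeTheory

namespace Summit.HodgeConjecture.HodgeConjecture.Theorems

/-! ### Transvection calculus: powers, scaling, conjugation, the two pairings, the four moves -/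

section Calculus

variable {G : Type*} [Group G] {V : Type*} [AddCommGroup V] [Module ℚ V]
  (ρ : G →* (V →ₗ[ℚ] V)) (B : LinearMap.BilinForm ℚ V)

/-- Powers of a transvection: if `g` acts as `T_v(x) = x - B(x, v) v` with `B(v, v) = 0`, then
`g^j` acts as `x ↦ x - j B(x, v) v`. [folklore] -/
theorem localTubeSpan_pow_transvection_formula (v : V) (hv : B v v = 0) (g : G)
    (hg : ∀ x, ρ g x = x - B x v • v) (k : ℕ) (x : V) :
    ρ (g ^ k) x = x - ((k : ℚ) * B x v) • v := by
  induction k generalizing x with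
  | zero => rw [pow_zero, map_one, Module.End.one_apply, Nat.cast_zero, zero_mul, zero_smul, sub_zero]
  | succ k ih =>
      rw [pow_succ, map_mul, Module.End.mul_apply, hg, ih, map_sub, map_smul, LinearMap.sub_apply,
        LinearMap.smul_apply, hv, smul_eq_mul, mul_zero, sub_zero, Nat.cast_succ, add_mul, one_mul,
        add_smul]
      abel

/-- Scaling a realised transvection: if some element of `H` acts as `T_v` (`B` alternating), then
some element of `H` acts as `T_{d v} = T_v^{d²}` for every `d ∈ ℤ`. [folklore] -/
theorem localTubeSpan_realised_smul_transvection (hB : B.IsAlt) (H : Subgroup G) {v : V}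
    (hv : ∃ g ∈ H, ∀ x, ρ g x = x - B x v • v) (d : ℤ) :
    ∃ g ∈ H, ∀ x, ρ g x = x - B x ((d : ℚ) • v) • ((d : ℚ) • v) := by
  obtain ⟨g, hg, hgx⟩ := hv
  refine ⟨g ^ (d.natAbs * d.natAbs), H.pow_mem hg _, fun x => ?_⟩
  have hc : ((d.natAbs * d.natAbs : ℕ) : ℚ) * B x v = (d : ℚ) * B x v * d := by
    rw [← Int.cast_natCast, Int.natAbs_mul_self, Int.cast_mul]
    ring
  rw [localTubeSpan_pow_transvection_formula ρ B v (hB.self_eq_zero v) g hgx, hc, map_smul,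
    smul_eq_mul, smul_smul]

/-- Conjugate meridians act as transvections along the transported cycles (single-isometry form):
if `h` acts by a `B`-isometry and `g` acts as `T_v`, then `h g h⁻¹` acts as `T_{h · v}`.
[cite: Schnell2010, §7 (Skew-symmetric vanishing lattices)] -/
theorem localTubeSpan_conj_transvection_formula_of_isometry {h : G}
    (hiso : ∀ x y, B (ρ h x) (ρ h y) = B x y) (g : G) (v : V)
    (hg : ∀ x, ρ g x = x - B x v • v) (x : V) :
    ρ (h * g * h⁻¹) x = x - B x (ρ h v) • ρ h v := by
  have e1 : B (ρ h⁻¹ x) v = B x (ρ h v) := by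
    rw [← hiso (ρ h⁻¹ x) v, ← Module.End.mul_apply, ← map_mul, mul_inv_cancel, map_one,
      Module.End.one_apply]
  rw [map_mul, map_mul, Module.End.mul_apply, Module.End.mul_apply, hg, map_sub, map_smul, e1,
    ← Module.End.mul_apply, ← map_mul, mul_inv_cancel, map_one, Module.End.one_apply]

/-- In a unimodular pencil `B(a, b) = 1` (`B` alternating): `B(p a + q b, b) = p`. [folklore] -/
theorem localTubeSpan_pencil_pairing_right (hB : B.IsAlt) (a b : V) (hab : B a b = 1) (p q : ℚ) :
    B (p • a + q • b) b = p := by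
  rw [map_add, map_smul, map_smul, LinearMap.add_apply, LinearMap.smul_apply, LinearMap.smul_apply,
    hab, hB.self_eq_zero, smul_eq_mul, smul_eq_mul, mul_one, mul_zero, add_zero]

/-- In a unimodular pencil `B(a, b) = 1` (`B` alternating): `B(p a + q b, a) = -q`. [folklore] -/
theorem localTubeSpan_pencil_pairing_left (hB : B.IsAlt) (a b : V) (hab : B a b = 1) (p q : ℚ) :
    B (p • a + q • b) a = -q := by
  rw [map_add, map_smul, map_smul, LinearMap.add_apply, LinearMap.smul_apply, LinearMap.smul_apply,
    hB.self_eq_zero, ← hB.neg_eq, hab, smul_eq_mul, smul_eq_mul, mul_zero, zero_add, mul_neg,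
    mul_one]

/-- Euclidean move `t_b · (m a + (n + m) b) = m a + n b`. [folklore] -/
theorem localTubeSpan_pencil_move_tb (hB : B.IsAlt) (a b : V) (hab : B a b = 1) (tb : G)
    (htb : ∀ x, ρ tb x = x - B x b • b) (m n : ℤ) :
    ρ tb ((m : ℚ) • a + ((n + m : ℤ) : ℚ) • b) = (m : ℚ) • a + (n : ℚ) • b := by
  rw [htb, localTubeSpan_pencil_pairing_right B hB a b hab, Int.cast_add, add_smul]
  abel

/-- Euclidean move `t_b⁻¹ · (m a + (n - m) b) = m a + n b`. [folklore] -/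
theorem localTubeSpan_pencil_move_tb_inv (hB : B.IsAlt) (a b : V) (hab : B a b = 1) (tb : G)
    (htb : ∀ x, ρ tb x = x - B x b • b) (m n : ℤ) :
    ρ tb⁻¹ ((m : ℚ) • a + ((n - m : ℤ) : ℚ) • b) = (m : ℚ) • a + (n : ℚ) • b := by
  rw [localTubeSpan_inv_transvection_formula ρ B hB tb b htb,
    localTubeSpan_pencil_pairing_right B hB a b hab, Int.cast_sub, sub_smul]
  abel

/-- Euclidean move `t_a · ((m - n) a + n b) = m a + n b`. [folklore] -/
theorem localTubeSpan_pencil_move_ta (hB : B.IsAlt) (a b : V) (hab : B a b = 1) (ta : G)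
    (hta : ∀ x, ρ ta x = x - B x a • a) (m n : ℤ) :
    ρ ta (((m - n : ℤ) : ℚ) • a + (n : ℚ) • b) = (m : ℚ) • a + (n : ℚ) • b := by
  rw [hta, localTubeSpan_pencil_pairing_left B hB a b hab, neg_smul, sub_neg_eq_add, Int.cast_sub,
    sub_smul]
  abel

/-- Euclidean move `t_a⁻¹ · ((m + n) a + n b) = m a + n b`. [folklore] -/
theorem localTubeSpan_pencil_move_ta_inv (hB : B.IsAlt) (a b : V) (hab : B a b = 1) (ta : G)
    (hta : ∀ x, ρ ta x = x - B x a • a) (m n : ℤ) :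
    ρ ta⁻¹ (((m + n : ℤ) : ℚ) • a + (n : ℚ) • b) = (m : ℚ) • a + (n : ℚ) • b := by
  rw [localTubeSpan_inv_transvection_formula ρ B hB ta a hta,
    localTubeSpan_pencil_pairing_left B hB a b hab, neg_smul, Int.cast_add, add_smul]
  abel

end Calculus

/-! ### Unimodular absorption -/

section Pencil

variable {G : Type} [Group G] (A : Rep.{0} ℚ G)

/-- The group generated by two elements acting as transvections of an alternating form acts by
`B`-isometries. [folklore] -/
theorem localTubeSpan_pencil_isometry (B : LinearMap.BilinForm ℚ A.V) (hB : B.IsAlt) (a b : A.V)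
    (ta tb : G) (hta : ∀ x : A.V, A.ρ ta x = x - B x a • a)
    (htb : ∀ x : A.V, A.ρ tb x = x - B x b • b) {g : G}
    (hg : g ∈ Subgroup.closure ({ta, tb} : Set G)) (x y : A.V) :
    B (A.ρ g x) (A.ρ g y) = B x y := by
  induction hg using Subgroup.closure_induction generalizing x y with
  | mem t ht =>
      simp only [Set.mem_insert_iff, Set.mem_singleton_iff] at ht
      rcases ht with rfl | rfl
      · exact localTubeSpan_isometry_of_transvection_formula B hB a (A.ρ t) hta x y
      · exact localTubeSpan_isometry_of_transvection_formula B hB b (A.ρ t) htb x y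
  | one => simp
  | mul g h _ _ ihg ihh => rw [map_mul, Module.End.mul_apply, Module.End.mul_apply, ihg, ihh]
  | inv g _ ih =>
      have := ih (A.ρ g⁻¹ x) (A.ρ g⁻¹ y)
      rw [← Module.End.mul_apply, ← Module.End.mul_apply, ← map_mul, mul_inv_cancel, map_one,
        Module.End.one_apply, Module.End.one_apply] at this
      exact this.symm

/-- **Unimodular absorption**, rational-coefficient form: if `t_a, t_b` act as the transvections
along `a, b` with `B(a, b) = 1` (`B` alternating), then for every `(m, n) ∈ ℤ²` some element of
`⟨t_a, t_b⟩` acts as the transvection along `m a + n b` (Euclid on `|m| + |n|`: the four moves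
`t_b^{±1}`, `t_a^{±1}` and conjugation; the axes `m a`, `n b` by `T_{d v} = T_v^{d²}`).
[cite: Schnell2010, §7 (Skew-symmetric vanishing lattices)] -/
theorem localTubeSpan_unimodularPencil_cast (B : LinearMap.BilinForm ℚ A.V) (hB : B.IsAlt)
    (a b : A.V) (hab : B a b = 1) (ta tb : G)
    (hta : ∀ x : A.V, A.ρ ta x = x - B x a • a) (htb : ∀ x : A.V, A.ρ tb x = x - B x b • b)
    (m n : ℤ) :
    ∃ g ∈ Subgroup.closure ({ta, tb} : Set G),
      ∀ x : A.V, A.ρ g x = x - B x ((m : ℚ) • a + (n : ℚ) • b) • ((m : ℚ) • a + (n : ℚ) • b) := by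
  have htaH : ta ∈ Subgroup.closure ({ta, tb} : Set G) :=
    Subgroup.subset_closure (Set.mem_insert ta {tb})
  have htbH : tb ∈ Subgroup.closure ({ta, tb} : Set G) :=
    Subgroup.subset_closure (Set.mem_insert_of_mem ta (Set.mem_singleton tb))
  induction hN : m.natAbs + n.natAbs using Nat.strong_induction_on generalizing m n with
  | h N ih =>
  rcases eq_or_ne n 0 with rfl | hn
  · simpa only [Int.cast_zero, zero_smul, add_zero] using
      localTubeSpan_realised_smul_transvection A.ρ B hB _ ⟨ta, htaH, hta⟩ m
  rcases eq_or_ne m 0 with rfl | hm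
  · simpa only [Int.cast_zero, zero_smul, zero_add] using
      localTubeSpan_realised_smul_transvection A.ρ B hB _ ⟨tb, htbH, htb⟩ n
  rcases le_or_gt m.natAbs n.natAbs with hle | hlt
  · rcases (show m.natAbs + (n - m).natAbs < N ∨ m.natAbs + (n + m).natAbs < N by omega)
      with h1 | h1
    · -- `m a + n b = t_b⁻¹ · (m a + (n - m) b)`
      obtain ⟨g, hg, hgx⟩ := ih _ h1 m (n - m) rfl
      refine ⟨tb⁻¹ * g * tb⁻¹⁻¹, mul_mem (mul_mem (inv_mem htbH) hg) (inv_mem (inv_mem htbH)),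
        fun x => ?_⟩
      rw [localTubeSpan_conj_transvection_formula_of_isometry A.ρ B
          (localTubeSpan_pencil_isometry A B hB a b ta tb hta htb (inv_mem htbH)) g _ hgx,
        localTubeSpan_pencil_move_tb_inv A.ρ B hB a b hab tb htb m n]
    · -- `m a + n b = t_b · (m a + (n + m) b)`
      obtain ⟨g, hg, hgx⟩ := ih _ h1 m (n + m) rfl
      refine ⟨tb * g * tb⁻¹, mul_mem (mul_mem htbH hg) (inv_mem htbH), fun x => ?_⟩
      rw [localTubeSpan_conj_transvection_formula_of_isometry A.ρ B
          (localTubeSpan_pencil_isometry A B hB a b ta tb hta htb htbH) g _ hgx,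
        localTubeSpan_pencil_move_tb A.ρ B hB a b hab tb htb m n]
  · rcases (show (m - n).natAbs + n.natAbs < N ∨ (m + n).natAbs + n.natAbs < N by omega)
      with h1 | h1
    · -- `m a + n b = t_a · ((m - n) a + n b)`
      obtain ⟨g, hg, hgx⟩ := ih _ h1 (m - n) n rfl
      refine ⟨ta * g * ta⁻¹, mul_mem (mul_mem htaH hg) (inv_mem htaH), fun x => ?_⟩
      rw [localTubeSpan_conj_transvection_formula_of_isometry A.ρ B
          (localTubeSpan_pencil_isometry A B hB a b ta tb hta htb htaH) g _ hgx,
        localTubeSpan_pencil_move_ta A.ρ B hB a b hab ta hta m n]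
    · -- `m a + n b = t_a⁻¹ · ((m + n) a + n b)`
      obtain ⟨g, hg, hgx⟩ := ih _ h1 (m + n) n rfl
      refine ⟨ta⁻¹ * g * ta⁻¹⁻¹, mul_mem (mul_mem (inv_mem htaH) hg) (inv_mem (inv_mem htaH)),
        fun x => ?_⟩
      rw [localTubeSpan_conj_transvection_formula_of_isometry A.ρ B
          (localTubeSpan_pencil_isometry A B hB a b ta tb hta htb (inv_mem htaH)) g _ hgx,
        localTubeSpan_pencil_move_ta_inv A.ρ B hB a b hab ta hta m n]

/-- **Unimodular absorption** (the registered stub `stub_unimodularPencil` of line `Sketch`,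
cycle 5).  If `t_a, t_b ∈ G` act on the vanishing cohomology as the Picard–Lefschetz
transvections along `a, b` with `⟨a, b⟩ = B(a, b) = 1` (`B` alternating), then for every
`(m, n) ∈ ℤ²` some element of the group `⟨t_a, t_b⟩` they generate acts as the transvection along
`m a + n b`: two meridians with unimodular pairing realise the transvection along EVERY vector of
the lattice `ℤ a + ℤ b` (the group acts on `ℚ a ⊕ ℚ b` as `SL₂(ℤ)` and trivially on its
`B`-orthogonal complement). [cite: Schnell2010, §7 (Skew-symmetric vanishing lattices)] -/
theorem localTubeSpan_unimodularPencil (B : LinearMap.BilinForm ℚ A.V) (hB : B.IsAlt) (a b : A.V)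
    (hab : B a b = 1) (ta tb : G)
    (hta : ∀ x : A.V, A.ρ ta x = x - B x a • a) (htb : ∀ x : A.V, A.ρ tb x = x - B x b • b)
    (m n : ℤ) :
    ∃ g ∈ Subgroup.closure ({ta, tb} : Set G),
      ∀ x : A.V, A.ρ g x = x - B x (m • a + n • b) • (m • a + n • b) := by
  rw [← Int.cast_smul_eq_zsmul ℚ m a, ← Int.cast_smul_eq_zsmul ℚ n b]
  exact localTubeSpan_unimodularPencil_cast A B hB a b hab ta tb hta htb m n

end Pencil

end Summit.HodgeConjecture.HodgeConjecture.Theorems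

end
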